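import Mathlib
import HarnessLib
import Summits.HubbardSuperconductivity.HubbardSuperconductivity.Theorems.KLProgrammeKLRegimeTwoVolumeTowerBaseGridActionProfile
import Summits.HubbardSuperconductivity.HubbardSuperconductivity.Theorems.KLProgrammeKLRegimeEngineScaleZeroE4PackageParts
import Summits.HubbardSuperconductivity.HubbardSuperconductivity.Theorems.KLProgrammeH10TwoPointLimitFramePerturbation

/-!
# Route `KLProgramme` — crux K3, VL child `KLRegimeVolumeLimitV17F2` (stmt-HubbardSuperconductivity-20440), skeleton «cauchy» v11: THE `hSup` DISCHARGER,
# part 5 — THE GRID-ACTION PROFILES OF THE BASE BUNDLE UNDER REGIME DOORS (conjuncts 6–7 of `hdataT` / atom `Hbase`; seat hubbard-kl-k3c4-p1 g16; `--supports` 20440)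

Conjuncts 6–7 of the base-transfer bundle `hdataT` (`…TowerTruncOfPartsS.towerDataTS_of_partsD`, atom `Hbase` of `…V11HSupOfAtoms`) ask, at both volumes, the
`(1 + labelDiam(Λg·tnorm))`-weighted pinned profile of the UV-stepped grid action `klGridAction V M β U μ K_V` in every degree with a VOLUME-FREE budget `ε_M·NG k`.
`…TowerBaseGridActionProfile.klGridAction_wtProfile_le` (k3c4-p1 g14) delivers it (rate `Λg = 1`) from: an admissible frame, the `gridLabelWt`-weighted rows/columns
`≤ αw` of the grid covariance above `Λ_1` — LANDED: k3c4-p2's `rowWt_/colWt_uvCovAt_le` (`…TopFrameGridDataAt`) with the uniform constant `uvAlphaAt_le_uniform` —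
the frame kernel's first moment `≤ F` — LANDED: `EngineV8.frameKernel_weightedL1_le` — and the smallness `θ̄ < 1`, which holds once `|U|` and the regime
constant `c` are small (`(n_β+1)U² ≤ c/log 4`, `PerturbedFermiCurve.sq_mul_nScales_succ_le`).  So these two conjuncts need NO supplier:

* `exists_uvAlpha_uniform` — ONE constant `Ag = Ag(R)` with the weighted rows/columns `≤ (4M/β)·Ag` (existential packaging of `uvAlphaAt_le_uniform`);
* **`exists_klGridAction_wtProfile_doors`** — for `R.WF`: doors `c₇, U₇ > 0` and a volume-free `NG ≥ 0` with, for every admissible frame `K` (`FrameOK R U (nScales β) μ K`),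
  `0 ≤ c ≤ c₇`, `klBetaMin ≤ β ≤ e^{c/U²}`, `0 < U ≤ U₇`, `klEngL₃ β U ≤ V`, `klEngM₃ β U V ≤ M`:
  `∀ k p y, Σ_{Y : Y p = y} ‖kernel (klGridAction V M β U μ K) k Y‖·(1 + labelDiam(1·tnorm)) ≤ ε_M·NG k`.

Proofs only; no definition.  Honest framing: explicit-constant bookkeeping over landed bounds; nothing here asserts any stub, K3, VL or superconductivity.
[cite: BenfattoGiulianiMastropietro2006, §2.1 (2.5), §2.5 (2.52)–(2.55), §3 (3.3)]
-/

noncomputable section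

namespace Summit.HubbardSuperconductivity.HubbardSuperconductivity.Theorems.TwoVolumeSource

set_option linter.dupNamespace false -- summit = problem name (single-conjunct summit), D-0017

open Finset Filter Topology Literature.MathematicalPhysics.QuantumLattice GrassmannAlgebra Literature.Probability.LatticeModels
  Literature.Probability.LatticeModels.BattleFederbush
open Summit.HubbardSuperconductivity.HubbardSuperconductivity.Theorems.KLRegimeSplit
open Summit.HubbardSuperconductivity.HubbardSuperconductivity.Theorems.KLProgrammeLegKernels
open Summit.HubbardSuperconductivity.HubbardSuperconductivity.Theorems.TwoPointAssembly
open Summit.HubbardSuperconductivity.HubbardSuperconductivity.Theorems.EngineV8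
open Summit.HubbardSuperconductivity.HubbardSuperconductivity.Theorems.TwoVolumeDefect

/-- **ONE uniform constant for the `gridLabelWt`-weighted rows/columns of the grid covariance above `Λ_1`**: `Ag = Ag(R)` with rows/columns `≤ (4M/β)·Ag`
for every admissible frame, `|U| ≤ 1`, `(Nsc+1)U² + 2|U| ≤ 3`, `klEngL₃ β U ≤ L`, `klEngM₃ β U L ≤ M` (k3c4-p2's `rowWt_/colWt_uvCovAt_le` ∘ `uvAlphaAt_le_uniform`).
[cite: BenfattoGiulianiMastropietro2006, §2.5 (2.52)–(2.55)] -/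
theorem exists_uvAlpha_uniform (R : RenConsts) :
    ∃ Ag : ℝ, ∀ {L M : ℕ} [NeZero L] [NeZero M] {U μ β : ℝ} {Nsc : ℕ} {K : TrigPolyC4v},
      FrameOK R U Nsc μ K → R.WF → |U| ≤ 1 → klBetaMin ≤ β → klEngL₃ β U ≤ L → klEngM₃ β U L ≤ M → ((Nsc : ℝ) + 1) * U ^ 2 + 2 * |U| ≤ 3 →
      (∀ X, ∑ Y, ‖((hubbardGridSub L M β (2 * (2 * M))).transpose * hubbardCovAboveCT L M β μ 0 K (klScale klE0 1) *
          hubbardGridSub L M β (2 * (2 * M))) X Y‖ * gridLabelWt L (2 * (2 * M)) β {gridLegPos X, gridLegPos Y} ≤ ((2 * (2 * M) : ℕ) : ℝ) / β * Ag) ∧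
      (∀ Y, ∑ X, ‖((hubbardGridSub L M β (2 * (2 * M))).transpose * hubbardCovAboveCT L M β μ 0 K (klScale klE0 1) *
          hubbardGridSub L M β (2 * (2 * M))) X Y‖ * gridLabelWt L (2 * (2 * M)) β {gridLegPos X, gridLegPos Y} ≤ ((2 * (2 * M) : ℕ) : ℝ) / β * Ag) := by
  have hΛ : 0 < klScale klE0 1 := klth_klScale_pos 1
  have hΛe : klScale klE0 1 ≤ klE0 := by unfold klScale klE0; norm_num
  exact ⟨_, fun {L M} _ _ {U μ β Nsc K} hK hR hU1 hβ hL hM hNU =>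
    ⟨fun X => (rowWt_uvCovAt_le hK hR hU1 hβ hL hM hΛ hΛe X).trans (mul_le_mul_of_nonneg_left (uvAlphaAt_le_uniform R hΛ hNU)
        (div_nonneg (Nat.cast_nonneg _) (KLRegimeSplit.pos_of_klBetaMin_le hβ).le)),
      fun Y => (colWt_uvCovAt_le hK hR hU1 hβ hL hM hΛ hΛe Y).trans (mul_le_mul_of_nonneg_left (uvAlphaAt_le_uniform R hΛ hNU)
        (div_nonneg (Nat.cast_nonneg _) (KLRegimeSplit.pos_of_klBetaMin_le hβ).le))⟩⟩

set_option maxHeartbeats 1600000 in -- explicit-constant bookkeeping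
/-- **THE GRID-ACTION PROFILES UNDER REGIME DOORS** (see the module docstring). [cite: BenfattoGiulianiMastropietro2006, §2.1 (2.5), §2.5 (2.52)–(2.55)] -/
theorem exists_klGridAction_wtProfile_doors (R : RenConsts) (hR : R.WF) :
    ∃ c₇ U₇ : ℝ, 0 < c₇ ∧ 0 < U₇ ∧ ∃ NG : ℕ → ℝ, (∀ k, 0 ≤ NG k) ∧
      ∀ {V M : ℕ} [NeZero V] [NeZero M] {U μ β c : ℝ} {K : TrigPolyC4v},
        FrameOK R U (nScales β) μ K → klBetaMin ≤ β → 0 ≤ c → c ≤ c₇ → β ≤ Real.exp (c / U ^ 2) → 0 < U → U ≤ U₇ →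
        klEngL₃ β U ≤ V → klEngM₃ β U V ≤ M →
        ∀ (k : ℕ) (p : Fin k) (y : GridLeg (GridPoint V (klGridN M))),
          ∑ Y ∈ univ.filter (fun Y : Fin k → GridLeg (GridPoint V (klGridN M)) => Y p = y),
              ‖kernel ℂ (klGridAction V M β U μ K) k Y‖ *
                (1 + labelDiam (fun Y₁ Y₂ : GridLeg (GridPoint V (klGridN M)) => (1 : ℝ) * (Torus.tnorm (Y₁.1.1.2 - Y₂.1.1.2) : ℝ)) (univ.image Y)) ≤
            imagTimeWeight β M * NG k := by
  obtain ⟨Ag, hAg⟩ := exists_uvAlpha_uniform R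
  have hlog : 0 < Real.log 4 := Real.log_pos (by norm_num)
  -- constants
  set A₁ : ℝ := max Ag 0 + 1 with hA₁def
  have hA₁ : 0 < A₁ := by have := le_max_right Ag 0; positivity
  set κ₀ : ℝ := Real.sqrt (2 * (7 + 6593)) with hκ₀def
  have hκ₀ : 0 < κ₀ := Real.sqrt_pos.2 (by norm_num)
  set C₁ : ℝ := 6 * (Real.pi * R.Gfr 1 / 2 + Real.pi ^ 2 * R.Gfr 2 / (2 * Real.sqrt 2) + Real.pi ^ 3 * R.Gfr 3 / 8) with hC₁
  have hC₁0 : 0 ≤ C₁ := by have := hR.2.2 1; have := hR.2.2 2; have := hR.2.2 3; positivity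
  have hKF : 0 < klKappaFrameC R := klKappaFrameC_pos (hR.2.2 0)
  set CF : ℝ := klKappaFrameC R + 2 * C₁ with hCF
  have hCF0 : 0 ≤ CF := by positivity
  set Θ₀ : ℝ := ((Real.exp 2 * (κ₀ + 1)) ^ 2 * CF + (Real.exp 2 * (κ₀ + 1)) ^ 4) / 2 with hΘ₀
  have hΘ₀0 : 0 ≤ Θ₀ := by positivity
  set s : ℝ := κ₀ ^ 2 / (8 * Real.exp 1 * A₁ * (Θ₀ + 1)) with hs
  have hs0 : 0 < s := by positivity
  -- the doors: `U₇ := min (1/4) (s/2)`, `c₇ := min (log 4 / 4) (s · log 4 / 2)`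
  refine ⟨min (Real.log 4 / 4) (s * Real.log 4 / 2), min (1 / 4) (s / 2), lt_min (by positivity) (by positivity), lt_min (by norm_num) (by positivity),
    fun k => if Even k then (1 : ℝ)⁻¹ ^ k * (Real.exp 1 * (Θ₀ * s) / (1 - 1 / 2)) else 0, fun k => ?_, ?_⟩
  · dsimp only
    split_ifs
    · positivity
    · exact le_rfl
  intro V M _ _ U μ β c K hK hβ hc0 hcc hβc hU0 hUU hV hM
  have hβ0 : 0 < β := KLRegimeSplit.pos_of_klBetaMin_le hβ
  have hMβ : β ≤ (M : ℝ) := le_of_klEngM₃_le hβ hV hM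
  have hM0 : (0 : ℝ) < M := lt_of_lt_of_le hβ0 hMβ
  have hUabs : |U| = U := abs_of_pos hU0
  have hU1 : |U| ≤ 1 := by rw [hUabs]; linarith [hUU.trans (min_le_left _ _)]
  have hcs : c / Real.log 4 ≤ s / 2 := by
    rw [div_le_iff₀ hlog]; have := hcc.trans (min_le_right _ _); linarith
  have hc4 : c / Real.log 4 ≤ 1 / 4 := by
    rw [div_le_iff₀ hlog]; have := hcc.trans (min_le_left _ _); linarith
  have hUs : U ≤ s / 2 := hUU.trans (min_le_right _ _)
  have hU4 : U ≤ 1 / 4 := hUU.trans (min_le_left _ _)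
  -- `(n_β + 1)·U² ≤ c / log 4`
  have hnU : U ^ 2 * ((nScales β : ℝ) + 1) ≤ c / Real.log 4 := PerturbedFermiCurve.sq_mul_nScales_succ_le hc0 hβ hβc
  have hNU : ((nScales β : ℝ) + 1) * U ^ 2 + 2 * |U| ≤ 3 := by rw [hUabs]; nlinarith
  -- rows / columns and the row constant `αw := (4M/β)·A₁`
  obtain ⟨hrow, hcol⟩ := hAg hK hR hU1 hβ hV hM hNU
  have h4M : (0 : ℝ) < ((2 * (2 * M) : ℕ) : ℝ) := by push_cast; linarith
  have hcM : (0 : ℝ) < ((2 * (2 * M) : ℕ) : ℝ) / β := div_pos h4M hβ0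
  have hAgle : ((2 * (2 * M) : ℕ) : ℝ) / β * Ag ≤ ((2 * (2 * M) : ℕ) : ℝ) / β * A₁ :=
    mul_le_mul_of_nonneg_left ((le_max_left _ _).trans (by linarith)) hcM.le
  have hαw : 0 < ((2 * (2 * M) : ℕ) : ℝ) / β * A₁ := mul_pos hcM hA₁
  -- the frame kernel's first moment
  have hF : ∑ z : TorusSite 2 V, ‖framePosKernel V K z‖ * (1 + torusSiteDist z 0) ≤ CF * (|U| + c / Real.log 4) := by
    refine (frameKernel_weightedL1_le (L := V) hR hU0.ne' hU1 hK).trans ?_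
    have h1 : 2 * (((nScales β : ℝ) + 1) * U ^ 2 * C₁) ≤ 2 * C₁ * (c / Real.log 4) := by nlinarith
    have h2 : klKappaFrameC R * |U| ≤ klKappaFrameC R * (|U| + c / Real.log 4) := by
      have : 0 ≤ c / Real.log 4 := by positivity
      nlinarith
    have h3 : 2 * C₁ * (c / Real.log 4) ≤ 2 * C₁ * (|U| + c / Real.log 4) := by
      have : 0 ≤ |U| := abs_nonneg U
      nlinarith
    rw [hCF]; nlinarith
  -- `Θ ≤ Θ₀ · s`
  have hsum : |U| + c / Real.log 4 ≤ s := by rw [hUabs]; linarith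
  have hΘ : ((Real.exp 2 * (Real.sqrt (2 * (7 + 6593)) + 1)) ^ 2 * (CF * (|U| + c / Real.log 4)) +
      (Real.exp 2 * (Real.sqrt (2 * (7 + 6593)) + 1)) ^ 4 * |U|) / 2 ≤ Θ₀ * s := by
    rw [← hκ₀def, hΘ₀]
    have hc' : 0 ≤ c / Real.log 4 := by positivity
    have hUle : |U| ≤ s := by linarith
    have e2 : 0 ≤ (Real.exp 2 * (κ₀ + 1)) ^ 2 := by positivity
    have e4 : 0 ≤ (Real.exp 2 * (κ₀ + 1)) ^ 4 := by positivity
    have hsum0 : 0 ≤ |U| + c / Real.log 4 := by positivity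
    nlinarith [mul_le_mul_of_nonneg_left hsum (mul_nonneg e2 hCF0), mul_le_mul_of_nonneg_left hUle e4]
  -- the smallness `θ̄ ≤ 1/2`
  have hθb : Real.exp 1 * (((2 * (2 * M) : ℕ) : ℝ) / β * A₁) * (imagTimeWeight β M * (Θ₀ * s)) / Real.sqrt (2 * (7 + 6593)) ^ 2 ≤ 1 / 2 := by
    rw [← hκ₀def]
    have hε : imagTimeWeight β M = β / (2 * M) := rfl
    have hMc : (((2 * (2 * M) : ℕ) : ℝ)) = 4 * M := by push_cast; ring
    have hprod : ((2 * (2 * M) : ℕ) : ℝ) / β * A₁ * (imagTimeWeight β M * (Θ₀ * s)) = 2 * A₁ * Θ₀ * s := by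
      rw [hε, hMc]; field_simp; ring
    have hval : Real.exp 1 * (2 * A₁ * Θ₀ * s) / κ₀ ^ 2 = Θ₀ / (4 * (Θ₀ + 1)) := by
      rw [hs]; field_simp; ring
    rw [mul_assoc (Real.exp 1), hprod, hval, div_le_iff₀ (by positivity)]
    nlinarith
  have hK' : FrameOK R U (nScales β) μ K := hK
  have h := klGridAction_wtProfile_le (V := V) (M := M) hK' hβ (le_of_klEngL₃_le hV) hαw (fun X => (hrow X).trans hAgle) (fun Y => (hcol Y).trans hAgle)
    one_pos hF hΘ hθb (by norm_num)
  intro k p y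
  exact h k p y

end Summit.HubbardSuperconductivity.HubbardSuperconductivity.Theorems.TwoVolumeSource

end
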